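import Summits.Ventures.YMGap.Thresholds.CouplingDerivative
import Summits.Ventures.YMGap.Thresholds.CouplingDerivativeSUN
import Summits.Ventures.YMGap.Thresholds.CouplingDerivativeDim
import HarnessLib

/-!
# Venture YMGap — C-DIFF as a `ContDiffOn ℝ 1` statement: the strong-coupling state is LITERALLY `C¹` in the coupling on the
# open window (every Lipschitz cylinder observable; `SU(2)` `d = 4`, every `SU(N)` `d = 4`, every `SU(N)` every `d`)

HONEST FRAMING: venture file of the cell `pub-ymgap` (QuantumFields programme), seat ds-1; packaging corollaries of
`CouplingDerivative` / `CouplingDerivativeSUN` / `CouplingDerivativeDim`: the derivative exists at every interior point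
(`su2_hasDerivAt_integral_9_25` …) and equals the response series, which is continuous on the closed window
(`su2_continuousOn_responseSum` …), hence Mathlib's `ContDiffOn ℝ 1` on the open window
(`contDiffOn_succ_iff_deriv_of_isOpen`).  Exactly one derivative; NOT `C²`, NOT analyticity; lattice strong coupling;
nothing about the continuum or the Clay problem.

* `su2_contDiffOn_integral_9_25` — `SU(2)`, `d = 4`: `β_W ↦ ⟨F⟩_{β_W}` is `C¹` on `(0, 9/25)`;
* `contDiffOn_integral_SU_thooft` — every `SU(N)`, `N ≥ 2`, `d = 4`: `C¹` on `(0, N·9/308)`;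
* `contDiffOn_integral_dim_thooft` — every `SU(N)`, `N ≥ 2`, every `d ≥ 2`: `C¹` on `(0, N/(12(d−1)))`.
-/

noncomputable section

open MeasureTheory ProbabilityTheory Set
open scoped NNReal ContDiff
open Literature.MathematicalPhysics.QuantumLattice (LGConfig ZdEdge ZdPlaquette fundamentalRep ymGibbsMeasures)
open Literature.MathematicalPhysics.QuantumFieldTheory hiding ZdEdge
open Literature.MathematicalPhysics.QuantumFieldTheory.Balaban1983to89.StrongCouplingKernelWindow (oneLinkKRModulus_SU)

namespace Summit.Ventures.YMGap.CouplingResponse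

variable {d N : ℕ}

/-- From an interior derivative formula with a derivative continuous on the closure to `ContDiffOn ℝ 1` on the open
interval. [folklore] -/
theorem contDiffOn_one_of_hasDerivAt {Φ g : ℝ → ℝ} {a c : ℝ}
    (hderiv : ∀ t ∈ Ioo a c, HasDerivAt Φ (g t) t) (hg : ContinuousOn g (Icc a c)) :
    ContDiffOn ℝ 1 Φ (Ioo a c) := by
  rw [show (1 : WithTop ℕ∞) = 0 + 1 from (zero_add 1).symm, contDiffOn_succ_iff_deriv_of_isOpen isOpen_Ioo]
  refine ⟨fun t ht => (hderiv t ht).differentiableAt.differentiableWithinAt, fun h => ?_, ?_⟩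
  · exact absurd h (by simp)
  · rw [contDiffOn_zero]
    exact (hg.mono Ioo_subset_Icc_self).congr fun t ht => (hderiv t ht).deriv

/-- ★ **`SU(2)`, `d = 4`: the strong-coupling state is `C¹` in the Wilson coupling on `(0, 9/25)`** — for any DLR selection
`μ` on `[0, 9/25]` and every Lipschitz cylinder observable `F`, `β_W ↦ ⟨F⟩_{μ β_W}` is `ContDiffOn ℝ 1` on `Ioo 0 (9/25)`
(derivative = the response series `Σ_q Cov(F, W_q)`, `su2_hasDerivAt_integral_9_25`). [folklore] -/
theorem su2_contDiffOn_integral_9_25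
    {μ : ℝ → Measure (LGConfig 4 (Matrix.specialUnitaryGroup (Fin 2) ℂ))}
    (hμ : ∀ βW ∈ Icc (0 : ℝ) (9 / 25), μ βW ∈ ymGibbsMeasures (d := 4) (fundamentalRep (Fin 2)) (2 * (βW / 4)))
    {F : LGConfig 4 (Matrix.specialUnitaryGroup (Fin 2) ℂ) → ℝ} {Λ : Finset (ZdEdge 4)} {K : ℝ≥0}
    (hF : IsLipschitzCylinder (fundamentalRep (Fin 2)) F Λ K)
    {x₀ : Literature.Probability.LatticeModels.Site 4} {D : ℕ} (hD : ∀ e ∈ Λ, ‖e.1 - x₀‖ ≤ D) :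
    ContDiffOn ℝ 1 (fun t => ∫ U, F U ∂(μ t)) (Ioo (0 : ℝ) (9 / 25)) :=
  contDiffOn_one_of_hasDerivAt (fun _ ht => su2_hasDerivAt_integral_9_25 hμ hF hD ht)
    (su2_continuousOn_responseSum le_rfl hμ hF hD)

/-- ★ **Every `SU(N)`, `N ≥ 2`, `d = 4`: the strong-coupling state is `C¹` in the coupling on `(0, N·9/308)`**, hypothesis-free
(Bakry–Émery modulus), on every Lipschitz cylinder observable, along any DLR selection. [folklore] -/
theorem contDiffOn_integral_SU_thooft (hN : 2 ≤ N)
    {μ : ℝ → Measure (LGConfig 4 (Matrix.specialUnitaryGroup (Fin N) ℂ))}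
    (hμ : ∀ b ∈ Icc (0 : ℝ) ((N : ℝ) * (9 / 308)), μ b ∈ ymGibbsMeasures (d := 4) (fundamentalRep (Fin N)) b)
    {F : LGConfig 4 (Matrix.specialUnitaryGroup (Fin N) ℂ) → ℝ} {Λ : Finset (ZdEdge 4)} {KF : ℝ≥0}
    (hF : IsLipschitzCylinder (fundamentalRep (Fin N)) F Λ KF)
    {x₀ : Literature.Probability.LatticeModels.Site 4} {D : ℕ} (hD : ∀ e ∈ Λ, ‖e.1 - x₀‖ ≤ D) :
    ContDiffOn ℝ 1 (fun t => ∫ U, F U ∂(μ t)) (Ioo (0 : ℝ) ((N : ℝ) * (9 / 308))) := by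
  have hN0 : (0 : ℝ) < N := by exact_mod_cast (show 0 < N by omega)
  set b₁ : ℝ := (N : ℝ) * (9 / 308) with hb₁
  have hb₁N : b₁ / N = 9 / 308 := by rw [hb₁]; field_simp
  have hb₁0 : 0 ≤ b₁ := by positivity
  obtain ⟨h1, hK0, h4⟩ := StarSUN.bakryEmery_coef_le (by omega) hb₁0 hb₁N.le
  have hab : |b₁| / N = b₁ / N := by rw [abs_of_nonneg hb₁0]
  rw [hab] at h1 hK0 h4
  have hmod := oneLinkKRModulus_SU hN h1
  refine contDiffOn_one_of_hasDerivAt (fun _ ht => hasDerivAt_integral_SU_thooft hN hμ hF hD ht) ?_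
  exact continuousOn_const.mul (continuousOn_responseSum_SU (by omega) hK0 hmod le_rfl h4 hμ hF hD)

/-- ★ **Every `SU(N)`, `N ≥ 2`, EVERY DIMENSION `d ≥ 2`: the strong-coupling state on `ℤ^d` is `C¹` in the coupling on
`(0, N/(12(d−1)))`**, hypothesis-free, on every Lipschitz cylinder observable, along any DLR selection. [folklore] -/
theorem contDiffOn_integral_dim_thooft (hd : 2 ≤ d) (hN : 2 ≤ N)
    {μ : ℝ → Measure (LGConfig d (Matrix.specialUnitaryGroup (Fin N) ℂ))}
    (hμ : ∀ b ∈ Icc (0 : ℝ) ((N : ℝ) / (12 * ((d : ℝ) - 1))), μ b ∈ ymGibbsMeasures (d := d) (fundamentalRep (Fin N)) b)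
    {F : LGConfig d (Matrix.specialUnitaryGroup (Fin N) ℂ) → ℝ} {Λ : Finset (ZdEdge d)} {KF : ℝ≥0}
    (hF : IsLipschitzCylinder (fundamentalRep (Fin N)) F Λ KF)
    {x₀ : Literature.Probability.LatticeModels.Site d} {D : ℕ} (hD : ∀ e ∈ Λ, ‖e.1 - x₀‖ ≤ D) :
    ContDiffOn ℝ 1 (fun t => ∫ U, F U ∂(μ t)) (Ioo (0 : ℝ) ((N : ℝ) / (12 * ((d : ℝ) - 1)))) := by
  obtain ⟨h1, hK0, hdoor⟩ := bakryEmery_door_dim (N := N) hd (by omega)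
  refine contDiffOn_one_of_hasDerivAt (fun _ ht => hasDerivAt_integral_dim_thooft hd hN hμ hF hD ht) ?_
  exact continuousOn_const.mul
    (continuousOn_responseSum_dim hd (by omega) hK0 (oneLinkKRModulus_SU hN h1) le_rfl hdoor hμ hF hD)

end Summit.Ventures.YMGap.CouplingResponse

end
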